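import Summits.Parity.GeneralizedHardyLittlewood.Theorems.GreenTaoLevelTwoGITwoCyclicInverseTrilinear

/-!
# Route `GreenTaoLevelTwo`, crux `MNTwo` (stmt-Parity-21276), line `birth`, stub `stub_mnVertical`:
# the `U²`-dual estimate of GT 2008b Prop. 15 (orthogonality to almost linear phases on Bohr sets)

Brick for block V2 of the `stub_mnVertical` census (B. Green, T. Tao, *Quadratic uniformity of the
Möbius function*, Ann. Inst. Fourier 58 (2008) = arXiv:math/0606087, §6, end of the proof of Prop. 15:
"`𝔼_{h₁,h₂,x} μ̃(x) f(x+h₁+h₂) F(h₁) F(h₂) = Σ_ξ μ̃^(ξ) f^(−ξ) F^(ξ)²` … Since `f` and `F` are bounded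
… and `μ̃^(ξ) ≪_A log^{−A} N` for any `ξ`, the claim follows").  Def-free, in sum form over `ℤ/Nℤ`,
deduced from the tree's `fgh`-lemma `norm_trilinear_sq_le` (GT08a Lemma 23) by fixing `h₂`:

* `norm_sum_sum_sum_shift_le` — for `‖f‖ ≤ 1`, `‖F‖ ≤ 1` on `A` and `‖Σ_x a(x) e(xξ/N)‖ ≤ D` for
  all `ξ`: `‖Σ_{h₂∈A} Σ_{h₁∈A} Σ_x a(x) F(h₁) F(h₂) f(x+h₁+h₂)‖ ≤ #A · √(#A·N) · D`.

References: [GreenTao2008QuadraticMobius] arXiv:math/0606087 §6, proof of Proposition 15;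
[GreenTao2008U3Inverse] arXiv:math/0503014 Lemma 23 (tree).
-/

noncomputable section

namespace Summit.Parity.GeneralizedHardyLittlewood.GreenTaoLevelTwoMNTwoDualTrilinear

open Finset ZMod
open scoped Pointwise
open Literature.NumberTheory.Sieve
open Summit.Parity.GeneralizedHardyLittlewood.GreenTaoLevelTwoGITwoCyclicInverse (norm_trilinear_sq_le)

variable {N : ℕ} [NeZero N]

/-- **The `U²`-dual estimate (GT 2008b, proof of Prop. 15).**  If `‖f‖ ≤ 1`, `‖F‖ ≤ 1` on `A` and
every Fourier coefficient of `a` is at most `D`, then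
`‖Σ_{h₂∈A} Σ_{h₁∈A} Σ_x a(x) F(h₁) F(h₂) f(x+h₁+h₂)‖ ≤ #A · √(#A · N) · D`.
[cite: GreenTao2008QuadraticMobius, proof of Proposition 15] -/
theorem norm_sum_sum_sum_shift_le (A : Finset (ZMod N)) (a f F : ZMod N → ℂ)
    (hf : ∀ y, ‖f y‖ ≤ 1) (hF : ∀ h ∈ A, ‖F h‖ ≤ 1) {D : ℝ} (hD0 : 0 ≤ D)
    (hD : ∀ ξ : ZMod N, ‖∑ x : ZMod N, a x * stdAddChar (x * ξ)‖ ≤ D) :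
    ‖∑ h₂ ∈ A, ∑ h₁ ∈ A, ∑ x : ZMod N, a x * F h₁ * F h₂ * f (x + h₁ + h₂)‖ ≤
      #A * Real.sqrt (#A * N) * D := by
  classical
  have hNpos : (0 : ℝ) < N := by exact_mod_cast Nat.pos_of_ne_zero (NeZero.ne N)
  -- the inner double sum for fixed `h₂`
  have hinner : ∀ h₂ : ZMod N,
      ‖∑ x : ZMod N, ∑ h₁ ∈ A, a x * F h₁ * f (x + h₁ + h₂)‖ ≤ Real.sqrt (#A * N) * D := by
    intro h₂
    obtain ⟨ξ₀, hξ₀⟩ := norm_trilinear_sq_le A (Finset.univ : Finset (ZMod N)) a F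
      (fun y => f (y + h₂)) hF (fun y => hf _)
    have hcard : (#((Finset.univ : Finset (ZMod N)) + A) : ℝ) ≤ N := by
      have : #((Finset.univ : Finset (ZMod N)) + A) ≤ #(Finset.univ : Finset (ZMod N)) :=
        card_le_card (subset_univ _)
      rw [card_univ, ZMod.card] at this
      exact_mod_cast this
    have h1 : ‖∑ x : ZMod N, ∑ h₁ ∈ A, a x * F h₁ * f (x + h₁ + h₂)‖ ^ 2 ≤ (#A * N) * D ^ 2 := by
      refine hξ₀.trans ?_
      have h2 : ‖∑ z : ZMod N, a z * stdAddChar (z * ξ₀)‖ ^ 2 ≤ D ^ 2 :=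
        pow_le_pow_left₀ (norm_nonneg _) (hD ξ₀) 2
      have h2' : (#A : ℝ) * #((Finset.univ : Finset (ZMod N)) + A) ≤ #A * N :=
        mul_le_mul_of_nonneg_left hcard (Nat.cast_nonneg _)
      exact mul_le_mul h2' h2 (sq_nonneg _) (by positivity)
    have h5 : Real.sqrt (‖∑ x : ZMod N, ∑ h₁ ∈ A, a x * F h₁ * f (x + h₁ + h₂)‖ ^ 2) ≤
        Real.sqrt ((#A * N) * D ^ 2) := Real.sqrt_le_sqrt h1
    rw [Real.sqrt_sq (norm_nonneg _), Real.sqrt_mul (by positivity), Real.sqrt_sq hD0] at h5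
    exact h5
  -- sum over `h₂`
  have hrw : ∀ h₂ ∈ A, ∑ h₁ ∈ A, ∑ x : ZMod N, a x * F h₁ * F h₂ * f (x + h₁ + h₂) =
      F h₂ * ∑ x : ZMod N, ∑ h₁ ∈ A, a x * F h₁ * f (x + h₁ + h₂) := by
    intro h₂ _
    rw [Finset.sum_comm, Finset.mul_sum]
    refine Finset.sum_congr rfl fun x _ => ?_
    rw [Finset.mul_sum]
    exact Finset.sum_congr rfl fun h₁ _ => by ring
  rw [Finset.sum_congr rfl hrw]
  calc ‖∑ h₂ ∈ A, F h₂ * ∑ x : ZMod N, ∑ h₁ ∈ A, a x * F h₁ * f (x + h₁ + h₂)‖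
      ≤ ∑ h₂ ∈ A, ‖F h₂ * ∑ x : ZMod N, ∑ h₁ ∈ A, a x * F h₁ * f (x + h₁ + h₂)‖ := norm_sum_le _ _
    _ ≤ ∑ _h₂ ∈ A, Real.sqrt (#A * N) * D := Finset.sum_le_sum fun h₂ hh₂ => by
        rw [norm_mul]
        calc ‖F h₂‖ * ‖∑ x : ZMod N, ∑ h₁ ∈ A, a x * F h₁ * f (x + h₁ + h₂)‖
            ≤ 1 * (Real.sqrt (#A * N) * D) :=
              mul_le_mul (hF h₂ hh₂) (hinner h₂) (norm_nonneg _) zero_le_one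
          _ = Real.sqrt (#A * N) * D := one_mul _
    _ = #A * Real.sqrt (#A * N) * D := by rw [Finset.sum_const, nsmul_eq_mul]; ring

end Summit.Parity.GeneralizedHardyLittlewood.GreenTaoLevelTwoMNTwoDualTrilinear
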